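import Literature.NumberTheory.EllipticCurves.BinaryQuarticStabilizer
import HarnessLib

/-!
# The sextic covariant `g₆` of a binary quartic form and the syzygy
# `27 g₆² = g₄³ − 48 I f² g₄ − 64 J f³`

Topic `Literature/NumberTheory/EllipticCurves`; companion of `BinaryQuarticForms.lean` (the space
`V_K` of binary quartic forms `f = a x⁴ + b x³y + c x²y² + d xy³ + e y⁴`, the invariants
`I = 12ae − 3bd + c²`, `J = 72ace + 9bcd − 27ad² − 27eb² − 2c³`, the substitution action
`(f.subst γ)(x,y) = f((x,y)γ)`) and of `BinaryQuarticStabilizer.lean` (the twisted action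
`BinaryQuartic.twist γ f = (det γ)⁻² f((x,y)γ)` and the quartic covariant `BinaryQuartic.g4`).

This is the classical invariant theory behind the `2`-covering map from the genus-one curve
`z² = f(x,y)` to the elliptic curve `E_{I,J} : y² = x³ − (I/3)x − J/27`, the map underlying the
field-level parametrization "`E(K)/2E(K) ↔ K`-soluble classes of quartics with invariants `I`, `J`"
(Bhargava–Shankar, Ann. of Math. 181 (2015), Lemma 5.10 of the held arXiv text `arXiv:1006.1002v2`
= Thm 3.2 of the published version), in the normalisation of J. E. Cremona, *Classical invariants
and 2-descent on elliptic curves*, J. Symbolic Comput. 31 (2001) 71–87, §2: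

* `BinaryQuartic.g6 f x y` — the value at `(x,y)` of the sextic covariant
  `g₆ = (b³ + 8a²d − 4abc)x⁶ + 2(16a²e + 2abd − 4ac² + b²c)x⁵y + 5(8abe + b²d − 4acd)x⁴y²
   + 20(b²e − ad²)x³y³ − 5(8ade + bd² − 4bce)x²y⁴ − 2(16ae² + 2bde − 4c²e + cd²)xy⁵ − (d³ + 8be² − 4cde)y⁶`
  (Cremona 2001, §2, p. 74; `= (f_y ∂ₓg₄ − f_x ∂_y g₄)/12`);
* the **syzygy** `27 g₆² = g₄³ − 48 I f² g₄ − 64 J f³` (Cremona 2001, eq. (2.3)), an identity of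
  binary forms of degree `12` (`BinaryQuartic.syzygy`), and its source, the seminvariant syzygy
  `27 r² = p³ − 48 I a² p − 64 J a³` (eq. (2.2));
* the **covariance** of `g₆` (weight `3`) under substitutions, `g₆(f ∘ γ) = (det γ)³ · (g₆ f) ∘ γ`
  (Cremona 2001, §2, p. 74, definition of a covariant of order `w`), under scaling
  (`g₆(μf) = μ³ g₆(f)`) and under the twisted action (`g₆(γ · f) = (det γ)⁻³ (g₆ f) ∘ γ`), with the
  companion statements for values of `f` and `g₄`; compatibility of `g₄`, `g₆` with change of field.

All statements are polynomial identities, closed by `ring`.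

## References

* J. E. Cremona, J. Symbolic Comput. 31 (2001) 71–87, §2 (p. 74: `g₄`, `g₆`, covariants of order
  `w`; eq. (2.2), (2.3): the syzygies). [cite: Cremona2001, §2 eq. (2.3)]
* M. Bhargava, A. Shankar, Ann. of Math. (2) 181 (2015) 191–242, §5.2 of the held arXiv text
  (Lemma 5.10: "See, e.g., [CS] for an explicit construction of `Q_E`").
  [cite: BhargavaShankarAnnals2015, Lemma 5.10 (arXiv:1006.1002v2 numbering)]

## Design

`g₄` is the tree's `BinaryQuartic.g4` (a `BinaryQuartic`, `BinaryQuarticStabilizer.lean`); `g₆`,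
a sextic, is kept as its evaluation function `K → K → K` (the tree has no type of binary sextics
and none is needed: only values of `g₆` at points enter the `2`-covering map). Everything is over
a field `K`, as `BinaryQuartic.g4` is.
-/

noncomputable section

namespace Literature.NumberTheory.EllipticCurves

namespace BinaryQuartic

variable {K L : Type*} [Field K] [Field L]

/-! ## The sextic covariant -/

/-- The value at `(x, y)` of the sextic covariant
`g₆(f) = (b³ + 8a²d − 4abc)x⁶ + 2(16a²e + 2abd − 4ac² + b²c)x⁵y + 5(8abe + b²d − 4acd)x⁴y²
+ 20(b²e − ad²)x³y³ − 5(8ade + bd² − 4bce)x²y⁴ − 2(16ae² + 2bde − 4c²e + cd²)xy⁵ − (d³ + 8be² − 4cde)y⁶`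
(Cremona 2001, §2, p. 74: the covariant whose source is `r = b³ + 8a²d − 4abc`; it equals
`(f_y ∂ₓg₄ − f_x ∂_yg₄)/12`). [cite: Cremona2001, §2 p. 74 (g₆)] -/
def g6 (f : BinaryQuartic K) (x y : K) : K :=
  (f.b ^ 3 + 8 * f.a ^ 2 * f.d - 4 * f.a * f.b * f.c) * x ^ 6
    + 2 * (16 * f.a ^ 2 * f.e + 2 * f.a * f.b * f.d - 4 * f.a * f.c ^ 2 + f.b ^ 2 * f.c) * x ^ 5 * y
    + 5 * (8 * f.a * f.b * f.e + f.b ^ 2 * f.d - 4 * f.a * f.c * f.d) * x ^ 4 * y ^ 2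
    + 20 * (f.b ^ 2 * f.e - f.a * f.d ^ 2) * x ^ 3 * y ^ 3
    - 5 * (8 * f.a * f.d * f.e + f.b * f.d ^ 2 - 4 * f.b * f.c * f.e) * x ^ 2 * y ^ 4
    - 2 * (16 * f.a * f.e ^ 2 + 2 * f.b * f.d * f.e - 4 * f.c ^ 2 * f.e + f.c * f.d ^ 2) * x * y ^ 5
    - (f.d ^ 3 + 8 * f.b * f.e ^ 2 - 4 * f.c * f.d * f.e) * y ^ 6

/-- `g₄(1,0) = p = 3b² − 8ac`, the source of `g₄` (Cremona 2001, §2). [cite: Cremona2001, §2 p. 74] -/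
theorem g4_eval_one_zero (f : BinaryQuartic K) : (g4 f).eval 1 0 = 3 * f.b ^ 2 - 8 * f.a * f.c := by
  simp [eval, g4]

/-- `g₆(1,0) = r = b³ + 8a²d − 4abc`, the source of `g₆` (Cremona 2001, §2). [cite: Cremona2001, §2 p. 74] -/
theorem g6_one_zero (f : BinaryQuartic K) :
    f.g6 1 0 = f.b ^ 3 + 8 * f.a ^ 2 * f.d - 4 * f.a * f.b * f.c := by
  simp [g6]

/-- `g₄(0,1) = 3d² − 8ce` (the source of `g₄` for the reversed form). [cite: Cremona2001, §2 p. 74] -/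
theorem g4_eval_zero_one (f : BinaryQuartic K) : (g4 f).eval 0 1 = 3 * f.d ^ 2 - 8 * f.c * f.e := by
  simp [eval, g4]

/-- `g₆(0,1) = −(d³ + 8be² − 4cde)`. [cite: Cremona2001, §2 p. 74] -/
theorem g6_zero_one (f : BinaryQuartic K) :
    f.g6 0 1 = -(f.d ^ 3 + 8 * f.b * f.e ^ 2 - 4 * f.c * f.d * f.e) := by
  simp [g6]

/-! ## The syzygy -/

/-- **The covariant syzygy** `27 g₆² = g₄³ − 48 I f² g₄ − 64 J f³` (Cremona 2001, eq. (2.3)), as an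
identity between the values at every `(x, y)`; at `(x,y) = (1,0)` it is the seminvariant syzygy
`27 r² = p³ − 48 a² p I − 64 a³ J` (eq. (2.2)). [cite: Cremona2001, §2 eq. (2.3)] -/
theorem syzygy (f : BinaryQuartic K) (x y : K) :
    27 * f.g6 x y ^ 2 =
      (g4 f).eval x y ^ 3 - 48 * f.I * f.eval x y ^ 2 * (g4 f).eval x y
        - 64 * f.J * f.eval x y ^ 3 := by
  simp only [g6, g4, eval, I, J]
  ring

/-- The seminvariant syzygy `27 r² = p³ − 48 I a² p − 64 J a³` (Cremona 2001, eq. (2.2)).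
[cite: Cremona2001, §2 eq. (2.2)] -/
theorem seminvariant_syzygy (f : BinaryQuartic K) :
    27 * (f.b ^ 3 + 8 * f.a ^ 2 * f.d - 4 * f.a * f.b * f.c) ^ 2 =
      (3 * f.b ^ 2 - 8 * f.a * f.c) ^ 3 - 48 * f.I * f.a ^ 2 * (3 * f.b ^ 2 - 8 * f.a * f.c)
        - 64 * f.J * f.a ^ 3 := by
  simp only [I, J]
  ring

/-! ## Change of field, scaling, homogeneity -/

/-- `g₄` commutes with change of field. [folklore] -/
theorem g4_map (φ : K →+* L) (f : BinaryQuartic K) : g4 (f.map φ) = (g4 f).map φ := by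
  ext <;> simp only [g4, map, map_sub, map_mul, map_pow, map_ofNat]

/-- `g₆` commutes with change of field. [folklore] -/
theorem g6_map (φ : K →+* L) (f : BinaryQuartic K) (x y : K) :
    (f.map φ).g6 (φ x) (φ y) = φ (f.g6 x y) := by
  simp only [g6, map, map_add, map_sub, map_mul, map_pow, map_ofNat]

/-- `g₆(μ f) = μ³ g₆(f)`: `g₆` is cubic in the coefficients. [cite: Cremona2001, §2 (r has degree 3)] -/
theorem g6_smul (μ : K) (f : BinaryQuartic K) (x y : K) : (μ • f).g6 x y = μ ^ 3 * f.g6 x y := by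
  simp only [g6, smul_a, smul_b, smul_c, smul_d, smul_e]
  ring

/-- Values of `f` are homogeneous of degree `4` in `(x, y)`. [folklore] -/
theorem eval_smul_smul (f : BinaryQuartic K) (t x y : K) :
    f.eval (t * x) (t * y) = t ^ 4 * f.eval x y := by
  simp only [eval]
  ring

/-- Values of `g₄` are homogeneous of degree `4` in `(x, y)`. [folklore] -/
theorem g4_eval_smul_smul (f : BinaryQuartic K) (t x y : K) :
    (g4 f).eval (t * x) (t * y) = t ^ 4 * (g4 f).eval x y := by
  simp only [eval]
  ring

/-- Values of `g₆` are homogeneous of degree `6` in `(x, y)`. [folklore] -/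
theorem g6_smul_smul (f : BinaryQuartic K) (t x y : K) :
    f.g6 (t * x) (t * y) = t ^ 6 * f.g6 x y := by
  simp only [g6]
  ring

/-! ## Covariance under substitutions and under the twisted action -/

/-- **`g₆` is a covariant of weight `3`**: `g₆(f ∘ γ)(x,y) = (det γ)³ · g₆(f)((x,y)γ)`
(Cremona 2001, §2, p. 74: "a covariant of order `w` … satisfying
`C(a*,…,e*,X,Y) = det(A)^w C(a,…,e,αX+βY,γX+δY)`", with `w = 3` for `g₆`).
[cite: Cremona2001, §2 p. 74 (covariance of g₆)] -/
theorem g6_subst (f : BinaryQuartic K) (γ : Matrix (Fin 2) (Fin 2) K) (x y : K) :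
    (f.subst γ).g6 x y =
      γ.det ^ 3 * f.g6 (x * γ 0 0 + y * γ 1 0) (x * γ 0 1 + y * γ 1 1) := by
  simp only [g6, subst, Matrix.det_fin_two]
  ring

/-- Values of `g₄` of a substituted form: `g₄(f ∘ γ)(x,y) = (det γ)² · g₄(f)((x,y)γ)` (the
evaluated form of `BinaryQuartic.g4_subst`). [cite: Cremona2001, §2 p. 74 (covariance of g₄)] -/
theorem g4_subst_eval (f : BinaryQuartic K) (γ : Matrix (Fin 2) (Fin 2) K) (x y : K) :
    (g4 (f.subst γ)).eval x y =
      γ.det ^ 2 * (g4 f).eval (x * γ 0 0 + y * γ 1 0) (x * γ 0 1 + y * γ 1 1) := by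
  rw [g4_subst, eval_smul, eval_subst]

/-- Values of a twisted form: `(γ · f)(x,y) = (det γ)⁻² f((x,y)γ)`. [cite: BhargavaShankarAnnals2015, §3.3 p. 15 (twisted action; arXiv:1006.1002v2 numbering)] -/
theorem eval_twist (γ : Matrix (Fin 2) (Fin 2) K) (f : BinaryQuartic K) (x y : K) :
    (twist γ f).eval x y = (γ.det ^ 2)⁻¹ * f.eval (x * γ 0 0 + y * γ 1 0) (x * γ 0 1 + y * γ 1 1) := by
  rw [twist, eval_smul, eval_subst]

/-- Values of `g₄` of a twisted form: `g₄(γ · f)(x,y) = (det γ)⁻² g₄(f)((x,y)γ)`.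
[cite: Cremona2001, §2 p. 74 (covariance of g₄)] -/
theorem g4_twist_eval {γ : Matrix (Fin 2) (Fin 2) K} (hγ : γ.det ≠ 0) (f : BinaryQuartic K)
    (x y : K) :
    (g4 (twist γ f)).eval x y =
      (γ.det ^ 2)⁻¹ * (g4 f).eval (x * γ 0 0 + y * γ 1 0) (x * γ 0 1 + y * γ 1 1) := by
  rw [twist, g4_smul, eval_smul, g4_subst_eval]
  field_simp

/-- Values of `g₆` of a twisted form: `g₆(γ · f)(x,y) = (det γ)⁻³ g₆(f)((x,y)γ)`.
[cite: Cremona2001, §2 p. 74 (covariance of g₆)] -/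
theorem g6_twist {γ : Matrix (Fin 2) (Fin 2) K} (hγ : γ.det ≠ 0) (f : BinaryQuartic K) (x y : K) :
    (twist γ f).g6 x y =
      (γ.det ^ 3)⁻¹ * f.g6 (x * γ 0 0 + y * γ 1 0) (x * γ 0 1 + y * γ 1 1) := by
  rw [twist, g6_smul, g6_subst]
  field_simp

end BinaryQuartic

end Literature.NumberTheory.EllipticCurves

end
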